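import Summits.HodgeConjecture.HodgeConjecture.Theorems.F0P3cStCharTSXiDict   -- ★ p851282∕p851487 (this seat): `exists_xiDict`, `exists_keysFields_Hv_labels`; brings ★ `localDet`, `continuous_localDet`, ★ KEYS-FIELDS
import Literature.NumberTheory.Automorphic.GLOneStandardLTate                    -- ★ `MonoidHom.continuous_of_continuous_val`
import HarnessLib

/-!
# F0 · P3c · line LH6 «StCharTS» — brick «XI-SURJ★» + «KEYS-PAIRS★» (datum road, S6 completed once more; stage B of «RED-JH ⟸ KEYS-RED», case (2)):
# EVERY CONTINUOUS PAIR `(η₁, η₂)` IS THE PARAMETER PAIR OF A CONTINUOUS CHARACTER OF `H_v`, AND THE LABEL FIELDS CARRY THEIR KEYS LABELS AT EVERY CONTINUOUS PAIR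

Cell `hodgecm-mathlib`, crux `H413` (`stmt-HodgeConjecture-24833`), line LH6 `Cruxes/H413/Lines/F0_P3c_StCharTSPaydown.lean` (organ (S-𝔇) `stub_EllipticPackage`).  Seat LH6-p03 (g4);
THEOREMS ONLY (no `def`, no named fact, no `instance`, no notation, no `sorry`; axioms ⊆ {propext, Classical.choice, Quot.sound}); `--supports stmt-HodgeConjecture-24833`.
A separate file because ★ `F0P3cStCharTSXiDict.lean` would pass the 400-line rule with these two sections.  HONEST LABEL: HC_CM is proved only modulo the 7 printed citations
(2 remaining: hLiu418 = stmt-HodgeConjecture-24832, h413 = stmt-HodgeConjecture-24833) until rung 0 closes; count-neutral datum-road brick, closes no organ.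

THE MATHEMATICS ([Rogawski1990, §12.2 (2) p. 173: the characters `ξ` of `H = U(2) × U(1)` trivial on `SU(2)` are `ξ(h₀, u) = η₁(det₀ h₀)·η₂(det₀ h₀ · det u)`; §13.3 p. 202];
[Keys1984, §7]).  ★ XI-DICT extracted from every `ξ′ : H_v →* ℂˣ` a continuous pair `ext ξ′`, equal to `(η₁, η₂)` whenever that continuous pair decomposes `ξ′`.  Conversely
(§1 here) every continuous pair decomposes SOME continuous `ξ′` — the product of homomorphisms `(η₁ ∘ det₀ ∘ pr₁) · (η₂ ∘ ((det₀ ∘ pr₁)·(det ∘ pr₂)))` into the commutative `ℂˣ`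
— so `ext` is onto the continuous pairs, and (§2) the label fields `pi2, piN` of ★ `exists_keysFields_Hv_labels` carry the Keys labels of `i_G(cmXiTorusChar L v μ_v η₁ η₂)` at
EVERY continuous pair, through a continuous `ξ′`: the form in which case (2) of the §12.2 list («`JH(i_G(χ)) = {π²(ξ), πⁿ(ξ)}`», ★ `F0P3cStCharTSEllClass`'s `hRedJH`) is read.

## References
* [Rogawski1990] J. D. Rogawski, *Automorphic Representations of Unitary Groups in Three Variables*, Ann. of Math. Stud. 123 (1990): §12.2 (2) pp. 173–174, §13.3 p. 202.
* [Keys1984] D. Keys, *Principal series representations of special unitary groups over local fields*, Compositio Math. 51 (1984): §7 Thm. p. 126.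
-/

set_option autoImplicit false
-- the mandated namespace has the single-problem summit's repeated segment (`HodgeConjecture.HodgeConjecture`)
set_option linter.dupNamespace false

noncomputable section

open NumberField IsDedekindDomain MeasureTheory
open scoped Matrix

open Literature.NumberTheory Literature.NumberTheory.Automorphic Literature.NumberTheory.Automorphic.UnitaryGroup
open Literature.NumberTheory.GaloisRepresentations
open Literature.NumberTheory.Rogawski1990

namespace Summit.HodgeConjecture.HodgeConjecture.Cruxes.H413.F0P3cStCharTSXiSurj

open Summit.HodgeConjecture.HodgeConjecture.Cruxes.H413.F0P3cStCharTSXiDict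

variable {L : Type} [Field L] [NumberField L] [IsCMField L]

/-! ## §1 Every continuous pair IS extracted: the character `ξ′ = η₁(det₀ h₀) · η₂(det₀ h₀ · det u)` of `H_v` («XI-SURJ★») -/

section Surj

variable (v : HeightOneSpectrum (𝓞 ↥(maximalRealSubfield L)))

/-- **«XI-SURJ★» — every continuous pair `(η₁, η₂)` of characters of `E¹_v` is the parameter pair of a CONTINUOUS character of `H_v = U(Φ₂)(L⁺_v) × U(Φ₁)(L⁺_v)`**,
namely `ξ′(h₀, u) := η₁(det₀ h₀) · η₂(det₀ h₀ · det u)` (the print's dictionary [§12.2 (2) p. 173; §13.3 p. 202] read backwards): `ξ′` is a group homomorphism (both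
determinants ★ `localDet` are, `ℂˣ` is commutative) and continuous (★ `continuous_localDet`, ★ `MonoidHom.continuous_of_continuous_val`).  With ★ `exists_xiDict` (b) this
makes the extraction `ext` SURJECTIVE onto the continuous pairs. [cite: Rogawski1990, §12.2 (2) p. 173; §13.3 p. 202] -/
theorem exists_xiChar_of_pair (η₁ η₂ : ↥(normOneUnits (conjLocal L (IsCMField.complexConj L) v)) →* ℂˣ)
    (h1 : Continuous (fun x => ((η₁ x : ℂˣ) : ℂ))) (h2 : Continuous (fun x => ((η₂ x : ℂˣ) : ℂ))) :
    ∃ ξ' : ((UnitaryGroup.cmDatum L 2 (Matrix.of fun i j : Fin 2 => if i.val + j.val + 1 = 2 then (1 : L) else 0)).Local v ×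
          (UnitaryGroup.cmDatum L 1 (Matrix.of fun i j : Fin 1 => if i.val + j.val + 1 = 1 then (1 : L) else 0)).Local v →* ℂˣ),
      Continuous ξ' ∧
        ∀ hh, ξ' hh = η₁ (localDet (IsCMField.complexConj L) v (isUnit_antidiagOne_det L 2) hh.1) *
          η₂ (localDet (IsCMField.complexConj L) v (isUnit_antidiagOne_det L 2) hh.1 * localDet (IsCMField.complexConj L) v (isUnit_antidiagOne_det L 1) hh.2) := by
  have hη₁ : Continuous η₁ := MonoidHom.continuous_of_continuous_val _ h1
  have hη₂ : Continuous η₂ := MonoidHom.continuous_of_continuous_val _ h2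
  have hd₂ := continuous_localDet (IsCMField.complexConj L) v (isUnit_antidiagOne_det L 2)
  have hd₁ := continuous_localDet (IsCMField.complexConj L) v (isUnit_antidiagOne_det L 1)
  -- `ξ′ := (η₁ ∘ det₀ ∘ pr₁) · (η₂ ∘ ((det₀ ∘ pr₁) · (det ∘ pr₂)))`, a product of homomorphisms into the commutative `ℂˣ`
  refine ⟨(η₁.comp ((localDet (IsCMField.complexConj L) v (isUnit_antidiagOne_det L 2)).comp (MonoidHom.fst _ _))) *
      (η₂.comp (((localDet (IsCMField.complexConj L) v (isUnit_antidiagOne_det L 2)).comp (MonoidHom.fst _ _)) *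
        ((localDet (IsCMField.complexConj L) v (isUnit_antidiagOne_det L 1)).comp (MonoidHom.snd _ _)))), ?_, fun hh => rfl⟩
  exact (hη₁.comp (hd₂.comp continuous_fst)).mul (hη₂.comp ((hd₂.comp continuous_fst).mul (hd₁.comp continuous_snd)))

end Surj

/-! ## §2 The label fields with their Keys labels AT EVERY CONTINUOUS PAIR — case (2) of «RED-JH ⟸ KEYS-RED» reads it -/

section PairFields

/-- **«KEYS-PAIRS★» — ★ `exists_keysFields_Hv_labels` with a sixth clause (f): for EVERY continuous pair `(η₁, η₂)` there is a CONTINUOUS `ξ′ : H_v →* ℂˣ` at which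
`(pi2 ξ′, piN ξ′)` is the Keys-labelled pair of `i_G(cmXiTorusChar L v μ_v η₁ η₂)`** (★ `KeysCaseTwoLabels`, which lists `JH(i_G(χ_ξ)) = {pi2 ξ′, piN ξ′}` and the two
square-integrability labels) — §1's `ξ′` (★ `exists_xiChar_of_pair`) read through clause (b).  Clauses (a)–(e) are ★ `exists_keysFields_Hv_labels`'s TOKEN FOR TOKEN, for
the SAME witnesses `pi2 := pi2′ ∘ ext`, `piN := piN′ ∘ ext`; (f) is what case (2) of the §12.2 list («`JH(i_G(χ)) = {π²(ξ), πⁿ(ξ)}`», ★ `F0P3cStCharTSEllClass`'s `hRedJH`)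
needs at a datum with `𝔇.pi2 = pi2`, `𝔇.piN = piN`. [cite: Rogawski1990, §12.2 (2) pp. 173–174; §13.3 p. 202] [cite: Keys1984, §7 Thm. p. 126] -/
theorem exists_keysFields_Hv_pairs (μ : HeckeCharacter L)
    (hμω : ∀ x : Literature.NumberTheory.GaloisRepresentations.ideleGroup ↥(maximalRealSubfield L),
      μ (AdeleRing.ideleBaseChange (↥(maximalRealSubfield L)) L x) = quadraticHeckeCharCM L x)
    (v : HeightOneSpectrum (𝓞 ↥(maximalRealSubfield L))) (hns : ∀ w : PlacesOver L v, IsCMField.complexConj L • w.1 = w.1)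
    [MeasurableSpace (Gqs L v)] [∀ γ : Gqs L v, MeasurableSpace (Gqs L v ⧸ Subgroup.centralizer ({γ} : Set (Gqs L v)))]
    [MeasurableSpace (Gqs L v ⧸ Subgroup.center (Gqs L v))] [BorelSpace (Gqs L v ⧸ Subgroup.center (Gqs L v))]
    [MeasurableSpace ((UnitaryGroup.cmDatum L 2 (Matrix.of fun i j : Fin 2 => if i.val + j.val + 1 = 2 then (1 : L) else 0)).Local v ×
        (UnitaryGroup.cmDatum L 1 (Matrix.of fun i j : Fin 1 => if i.val + j.val + 1 = 1 then (1 : L) else 0)).Local v)]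
    (μZ : Measure (Gqs L v ⧸ Subgroup.center (Gqs L v))) [μZ.IsHaarMeasure] :
    ∃ pi2 piN : ((UnitaryGroup.cmDatum L 2 (Matrix.of fun i j : Fin 2 => if i.val + j.val + 1 = 2 then (1 : L) else 0)).Local v ×
          (UnitaryGroup.cmDatum L 1 (Matrix.of fun i j : Fin 1 => if i.val + j.val + 1 = 1 then (1 : L) else 0)).Local v →* ℂˣ) → IrrClass (Gqs L v),
      (∀ ξ', (pi2 ξ').IsSquareIntegrable μZ ∧ ¬ (piN ξ').IsSquareIntegrable μZ) ∧
      (∀ (η₁ η₂ : ↥(normOneUnits (conjLocal L (IsCMField.complexConj L) v)) →* ℂˣ),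
        Continuous (fun x => ((η₁ x : ℂˣ) : ℂ)) → Continuous (fun x => ((η₂ x : ℂˣ) : ℂ)) →
        ∀ ξ', (∀ hh, ξ' hh = η₁ (localDet (IsCMField.complexConj L) v (isUnit_antidiagOne_det L 2) hh.1) *
            η₂ (localDet (IsCMField.complexConj L) v (isUnit_antidiagOne_det L 2) hh.1 * localDet (IsCMField.complexConj L) v (isUnit_antidiagOne_det L 1) hh.2)) →
          KeysCaseTwoLabels L v (μ.semilocalComponent L v) η₁ η₂ (pi2 ξ') (piN ξ')) ∧
      (∀ ξ : OneDimAutRepH L,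
        KeysCaseTwoLabels L v (μ.semilocalComponent L v) (torusLocalComponent L (IsCMField.complexConj L) v ξ.η)
          (torusLocalComponent L (IsCMField.complexConj L) v ξ.ψ) (pi2 (ξ.xiLocalChar v)) (piN (ξ.xiLocalChar v))) ∧
      (∀ 𝔇 : Ch12Sec5.EllipticData (Gqs L v)
          ((UnitaryGroup.cmDatum L 2 (Matrix.of fun i j : Fin 2 => if i.val + j.val + 1 = 2 then (1 : L) else 0)).Local v ×
            (UnitaryGroup.cmDatum L 1 (Matrix.of fun i j : Fin 1 => if i.val + j.val + 1 = 1 then (1 : L) else 0)).Local v),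
        𝔇.pi2 = pi2 → 𝔇.piN = piN → 𝔇.μGZ = μZ →
          𝔇.PiNNotL2 ∧
            ∀ ξ' : ((UnitaryGroup.cmDatum L 2 (Matrix.of fun i j : Fin 2 => if i.val + j.val + 1 = 2 then (1 : L) else 0)).Local v ×
                (UnitaryGroup.cmDatum L 1 (Matrix.of fun i j : Fin 1 => if i.val + j.val + 1 = 1 then (1 : L) else 0)).Local v →* ℂˣ),
              Continuous ξ' → 𝔇.IsL2 (𝔇.pi2 ξ')) ∧
      (∀ ξ' : ((UnitaryGroup.cmDatum L 2 (Matrix.of fun i j : Fin 2 => if i.val + j.val + 1 = 2 then (1 : L) else 0)).Local v ×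
          (UnitaryGroup.cmDatum L 1 (Matrix.of fun i j : Fin 1 => if i.val + j.val + 1 = 1 then (1 : L) else 0)).Local v →* ℂˣ), Continuous ξ' →
        ∃ (η₁ η₂ : ↥(normOneUnits (conjLocal L (IsCMField.complexConj L) v)) →* ℂˣ),
          Continuous (fun x => ((η₁ x : ℂˣ) : ℂ)) ∧ Continuous (fun x => ((η₂ x : ℂˣ) : ℂ)) ∧
            KeysCaseTwoLabels L v (μ.semilocalComponent L v) η₁ η₂ (pi2 ξ') (piN ξ')) ∧
      ∀ (η₁ η₂ : ↥(normOneUnits (conjLocal L (IsCMField.complexConj L) v)) →* ℂˣ),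
        Continuous (fun x => ((η₁ x : ℂˣ) : ℂ)) → Continuous (fun x => ((η₂ x : ℂˣ) : ℂ)) →
        ∃ ξ' : ((UnitaryGroup.cmDatum L 2 (Matrix.of fun i j : Fin 2 => if i.val + j.val + 1 = 2 then (1 : L) else 0)).Local v ×
            (UnitaryGroup.cmDatum L 1 (Matrix.of fun i j : Fin 1 => if i.val + j.val + 1 = 1 then (1 : L) else 0)).Local v →* ℂˣ),
          Continuous ξ' ∧ KeysCaseTwoLabels L v (μ.semilocalComponent L v) η₁ η₂ (pi2 ξ') (piN ξ') := by
  obtain ⟨pi2, piN, hL2, hlab, hxi, hsock, hlabels⟩ := exists_keysFields_Hv_labels μ hμω v hns μZ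
  refine ⟨pi2, piN, hL2, hlab, hxi, hsock, hlabels, fun η₁ η₂ h1 h2 => ?_⟩
  obtain ⟨ξ', hξ'c, hξ'⟩ := exists_xiChar_of_pair v η₁ η₂ h1 h2
  exact ⟨ξ', hξ'c, hlab η₁ η₂ h1 h2 ξ' hξ'⟩

end PairFields

end Summit.HodgeConjecture.HodgeConjecture.Cruxes.H413.F0P3cStCharTSXiSurj

end
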